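import Summits.ABC.IUTFork.Thm311RealInd1StripPacketNormalisationTransfer
import HarnessLib

/-!
# [IUTchIII] Thm 3.11 (i) (Ind1)+(Ind2) on a TWO-FACTOR genuine packet, continued: the SLOT case of `e_{i₀} ∣ v`, the case `e_{i₀} ∣ v + 1` with BOTH bits
# failing, and the STRICTNESS of the three confinements against the container `p^{A}·log_p(R_I^×)` (all UNCONDITIONAL)

PROOF-ONLY file (abc-iut cell, Cor. 3.12 sub-crew, seat abc-iut-c312-1 = holder of record of the typed [IUTchIII] Thm. 3.11, gen 19; row «R25 =
C:NORMALISATION-TRANSFER», KEY NORMTRANSFER, C LEAD ruling C-R167 (a); file (B′), companion of `Thm311RealInd1StripPacketNormalisationTransfer` = (B), split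
off for the 400-line rule).  TAKES NO SIDE on [IUTchIII] Cor. 3.12.  No definition, no `Prop` fact, NO `JannsenWingbergMappingClass` (all unconditional).
SETTING of (B): `X = K_{w_{i₀}} ⊗ K_{w_{i₁}}` (index set `{i₀, i₁}`), both factors TAME, `‖g‖ = p^{−v/E}` (`E = e(w_{i₀}|p)`, `e₁ = e(w_{i₁}|p)`),
`v − 1 = E·B + r`, `A = (v−1) div E + 1 − 2 = B − 1`; `H` factorwise through the realised strip groups; failing bits displayed as `hfix`.
* §3 **`packetHull_orbit_smul_normalizedPacket_subset_polydisc_of_dvd_of_fixesBaseLine_slot`** — `E ∣ v` (`r = E − 1`), ¬bit at the SLOT `w_{i₀}` (`f = 1`):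
  hull ⊆ polydisc(`‖g‖·p^{1−1/e₁}`) (box `⊗(g, d₁⁻¹)·R_I` = depth-`E` ball ⊗ log-shell ball; Prop. 1.1 with `⋆ = i₀`).  With (B) §2: at `E ∣ v` a failing bit
  at EITHER factor confines the Θ-region's orbit — R24's two bits are both NECESSARY there.
* §4 **`packetHull_orbit_smul_normalizedPacket_subset_polydisc_of_dvd_succ_of_fixesBaseLine`** — `E ∣ v + 1` (`r = E − 2`), ¬bit at BOTH factors
  (`f = 1` both): hull ⊆ polydisc(`‖g‖·p^{1−1/E}` `= p^{−B}`) (box `⊗(g·d₀⁻¹, 1)·R_I` = `p^{B}·𝒪 ⊗ 𝒪`, two depth-`e` balls).  With (A′) §2 (one bit at EITHER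
  factor suffices at `r = E − 2`, mod hMC): exactly ONE bit is needed there.
* §5 **`packetHull_ne_of_subset_polydisc_of_lt`** (generic: a hull confined to a polydisc of radius `< ‖p^{A}‖·∏ p^{−1/e_i}` is NOT the container's hull,
  which attains that radius — (B) §1) and the three radius comparisons **`radius_offSlot_lt`** (`e₁ ≥ 2`: defect `(1 − 1/e₁)·log p`), **`radius_slot_lt`**
  (`E ≥ 2`: defect `(1 − 1/E)·log p`), **`radius_succ_lt`** (`1/E + 1/e₁ < 1`: defect `(1 − 1/E − 1/e₁)·log p`) — each `R' < ‖p^{A}‖·p^{−1/E}·p^{−1/e₁}` VERBATIM.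
READING (numbers about OUR typed objects; neutral): together with (A)/(A′)/(B) the two-factor picture at tame residue-degree-one factors is complete AS
TYPED: `r ≤ E − 3` (room) no bit · `r = E − 2` one bit at either factor, none ⟹ defect · `r = E − 1` both bits, either failing ⟹ defect; so R24's per-factor bit
family is SHARP exactly when `e_{i₀} ∣ v`.  Which value a bit takes is NOT claimed.  HONEST SCOPE as in (B): unconditional; OUR typings; EVEN degree, WILD,
`p = 2` outside; equal-AS-TYPED ≠ equal in print; nothing here asserts that abc is proved or refuted; no side taken on [IUTchIII] Cor. 3.12 / [IUTchIV]
Thm. 1.10, on (U) vs (P), or on any author. [claim: Mochizuki2012, status: disputed];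
[cite: Mochizuki2012, IUTchIII Thm. 3.11 (i) p. 154; Rmk. 3.9.5 (i) p. 127; Cor. 3.12 Step (xi) p. 183; IUTchIV Prop. 1.1 p. 9, Prop. 1.2 (ii) pp. 10–11, Prop. 1.4 (i) p. 13];
[cite: DupuyHilado2025, §4.9, §4.12]; [cite: SerreLocalFields1979, Ch. III §6 Prop. 13]. typed ≠ proved.
-/

set_option autoImplicit false

noncomputable section

open Metric Set Bornology Function
open scoped Pointwise TensorProduct NormedField

namespace Summit.ABC.IUTFork.Thm311.Real

open NumberField IsDedekindDomain Literature.NumberTheory.NumberFields Literature.IUT.LogVolume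
open Literature.NumberTheory.GaloisRepresentations Literature.NumberTheory.GaloisRepresentations.Ultrametric
open Literature.AnabelianGeometry.AbsoluteAnabelian Literature.IUT.HodgeArakelov
open Literature.IUT.HodgeArakelov.AbsTopMonoids

variable {K : Type} [Field K] [NumberField K] (p : ℕ) [hp : Fact p.Prime]
variable {I : Type} [Fintype I] [DecidableEq I] (w : I → HeightOneSpectrum (𝓞 K)) (hw : ∀ i, ((p : ℕ) : 𝓞 K) ∈ (w i).asIdeal)
variable (i₀ i₁ : I) (hne : i₀ ≠ i₁) (huniv : (Finset.univ : Finset I) = {i₀, i₁})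

/-! ## §3 `E ∣ v`, failing bit AT THE SLOT -/

include hne huniv in
/-- **§3 `E ∣ v`, FAILING bit AT the slot (UNCONDITIONAL).**  Two tame factors; `‖g‖ = p^{−v/E}` with `E ∣ v`; at `w_{i₀}` the residue degree is one and NO
realised strip automorphism moves `ℤ_p·p` modulo `p·log_p(𝒪^×)`; `H` factorwise through the strip groups.  Then the `(R_I)^∼`-hull of the `H`-orbit of
`ι_{i₀}(g)·(R_I)^∼` lies in the polydisc of radius `‖g‖·p^{1−1/e₁}`: Prop. 1.1 with `⋆ = i₀` puts the region in the box `⊗(g, d₁⁻¹)·R_I` = `g·𝒪_{w_{i₀}} ⊗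
p⁻¹·log_p(𝒪_{w_{i₁}}^×)`, a depth-`E` ball with a failing bit (strip-invariant, p550084) ⊗ a log-shell ball (strip-stable).  Container radius
`‖g‖·p^{2−1/E−1/e₁}`: defect `(1 − 1/E)·log p` (§5). [claim: Mochizuki2012, status: disputed]
[cite: Mochizuki2012, IUTchIII Thm. 3.11 (i) p. 154; Rmk. 3.9.5 (i) p. 127; IUTchIV Prop. 1.1 p. 9, Prop. 1.2 (ii) p. 10] [cite: DupuyHilado2025, §4.9, §4.12] -/
theorem packetHull_orbit_smul_normalizedPacket_subset_polydisc_of_dvd_of_fixesBaseLine_slot (hp2 : 2 < p)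
    (he : ∀ i, absRamificationIdx p (RescaledCompletion K p (w i) (hw i)) ≤ p - 2)
    {g : RescaledCompletion K p (w i₀) (hw i₀)} {v : ℤ}
    (hv : ‖g‖ = (p : ℝ) ^ (-(v / (absRamificationIdx p (RescaledCompletion K p (w i₀) (hw i₀)) : ℝ))))
    (hdvd : ((absRamificationIdx p (RescaledCompletion K p (w i₀) (hw i₀)) : ℤ)) ∣ v)
    (hf₀ : (w i₀).asIdeal.inertiaDeg ℤ = 1)
    (hfix₀ : ∀ ψ ∈ ind1StripOf (w i₀) (galoisLog (w i₀)),
      RescaledCompletion.of K p (w i₀) (hw i₀) (ψ (p : (w i₀).adicCompletion K)) - (p : RescaledCompletion K p (w i₀) (hw i₀)) ∈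
        (p : ℚ_[p]) • logUnits (RescaledCompletion K p (w i₀) (hw i₀)))
    (H : Subgroup (PacketAlgebra p (fun i => RescaledCompletion K p (w i) (hw i)) ≃ₗ[ℚ_[p]]
      PacketAlgebra p (fun i => RescaledCompletion K p (w i) (hw i))))
    (hHfac : ∀ γ ∈ H, ∃ δ : Π i, AddAut ((w i).adicCompletion K),
      (∀ i, δ i ∈ AddSubgroup.closure (G := AddAut ((w i).adicCompletion K)) (ind1StripOf (w i) (galoisLog (w i)))) ∧
      ∀ z : Π i, RescaledCompletion K p (w i) (hw i),
        γ (PiTensorProduct.tprod ℚ_[p] z) =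
          PiTensorProduct.tprod ℚ_[p] (fun i => RescaledCompletion.of K p (w i) (hw i)
            (δ i ((RescaledCompletion.of K p (w i) (hw i)).symm (z i))))) :
    packetHull p (fun i => RescaledCompletion K p (w i) (hw i))
        (⋃ γ : H, (γ : PacketAlgebra p (fun i => RescaledCompletion K p (w i) (hw i)) ≃ₗ[ℚ_[p]]
            PacketAlgebra p (fun i => RescaledCompletion K p (w i) (hw i))) ''
          (iota p (fun i => RescaledCompletion K p (w i) (hw i)) i₀ g •
            (normalizedPacket p (fun i => RescaledCompletion K p (w i) (hw i)) :
              Set (PacketAlgebra p (fun i => RescaledCompletion K p (w i) (hw i)))))) ⊆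
      dEquiv p (fun i => RescaledCompletion K p (w i) (hw i)) ⁻¹'
        polydisc (DFac p (fun i => RescaledCompletion K p (w i) (hw i)))
          (fun _ => ‖g‖ * (p : ℝ) ^ (1 - 1 / (absRamificationIdx p (RescaledCompletion K p (w i₁) (hw i₁)) : ℝ))) := by
  classical
  set k := fun i => RescaledCompletion K p (w i) (hw i) with hk
  set e := fun i => RescaledCompletion.of K p (w i) (hw i) with he_def
  set E : ℕ := absRamificationIdx p (k i₀) with hE
  set E₁ : ℕ := absRamificationIdx p (k i₁) with hE₁
  haveI : Nonempty I := ⟨i₀⟩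
  have hP : p.Prime := Fact.out
  have hp0 : (0 : ℝ) < p := by exact_mod_cast hP.pos
  have hpQ : (p : ℚ_[p]) ≠ 0 := by exact_mod_cast hP.ne_zero
  have hE0 : (0 : ℝ) < (E : ℝ) := by exact_mod_cast absRamificationIdx_pos p (k i₀)
  have hE₁0 : (0 : ℝ) < (E₁ : ℝ) := by exact_mod_cast absRamificationIdx_pos p (k i₁)
  have hmem : ∀ i, i = i₀ ∨ i = i₁ := fun i => by
    have hm := Finset.mem_univ i
    rw [huniv, Finset.mem_insert, Finset.mem_singleton] at hm
    exact hm
  obtain ⟨m, hm⟩ := hdvd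
  have hvE : (v : ℝ) / (E : ℝ) = m := by
    rw [hm]; push_cast; field_simp
  have hgn : ‖g‖ = (p : ℝ) ^ (-(m : ℝ)) := by
    rw [hv, show (v : ℝ) / (absRamificationIdx p (RescaledCompletion K p (w i₀) (hw i₀)) : ℝ) = (v : ℝ) / (E : ℝ) from rfl, hvE]
  -- the different generator at `i₁` and the box `⊗(g, d₁⁻¹)·R_I ⊇ ι_{i₀}(g)·(R_I)^∼` (Prop. 1.1 with `⋆ = i₀`)
  obtain ⟨d₁, hd₁, hd₁0, hnd₁⟩ := exists_different_generator_norm_eq p (k i₁) (he i₁)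
  have huniv' : (Finset.univ : Finset I) = {i₁, i₀} := by rw [huniv, Finset.pair_comm]
  have hReg : iota p k i₀ g • (normalizedPacket p k : Set (PacketAlgebra p k)) ⊆
      purePacket p k (Pi.mulSingle i₀ g * Pi.mulSingle i₁ ((d₁ : k i₁))⁻¹) • (integerPacket p k : Set (PacketAlgebra p k)) := by
    refine (Set.smul_set_mono (normalizedPacket_subset_iota_smul_integerPacket_of_two p k i₁ i₀ hne.symm huniv' d₁ hd₁ hd₁0)).trans ?_
    rw [smul_smul, iota_eq_purePacket, iota_eq_purePacket, purePacket_mul]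
  -- radii: `ρ_{i₀} = ‖p^{m−1}‖·p⁻¹ = ‖g‖` (depth-`E` ball), `ρ_{i₁} = ‖p⁻¹‖·p^{−1/e₁} = ‖d₁⁻¹‖` (log-shell ball)
  let ρ : I → ℝ := fun i => if i = i₀ then ‖((p : ℚ_[p]) ^ (m - 1))‖ * (p : ℝ)⁻¹ else ‖((p : ℚ_[p])⁻¹)‖ * (p : ℝ) ^ (-(1 / (E₁ : ℝ)))
  have hρ₀ : ρ i₀ = ‖g‖ := by
    simp only [ρ, if_pos rfl]
    rw [hgn, norm_zpow, Padic.norm_p, inv_zpow', ← Real.rpow_intCast, ← Real.rpow_neg_one, ← Real.rpow_add hp0]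
    push_cast; ring_nf
  have hρ₁ : ρ i₁ = (p : ℝ) ^ (1 - 1 / (E₁ : ℝ)) := by
    simp only [ρ, if_neg hne.symm]
    rw [norm_inv, Padic.norm_p, inv_inv]
    simp only [Real.rpow_neg hp0.le, Real.rpow_sub hp0, Real.rpow_one, div_eq_mul_inv]
  have hρ0 : ∀ i, 0 ≤ ρ i := fun i => by simp only [ρ]; split_ifs <;> positivity
  have hh : ∀ i, ‖(Pi.mulSingle i₀ g * Pi.mulSingle i₁ ((d₁ : k i₁))⁻¹ : Π i, k i) i‖ ≤ ρ i := by
    intro i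
    rcases hmem i with rfl | rfl
    · rw [Pi.mul_apply, Pi.mulSingle_eq_same, Pi.mulSingle_eq_of_ne hne, mul_one, hρ₀]
    · rw [Pi.mul_apply, Pi.mulSingle_eq_of_ne hne.symm, Pi.mulSingle_eq_same, one_mul, hρ₁, norm_inv, hnd₁,
        ← Real.rpow_neg hp0.le, neg_neg, hE₁, sub_div, div_self hE₁0.ne']
  have hstab : ∀ i, ∀ δ ∈ AddSubgroup.closure (G := AddAut ((w i).adicCompletion K)) (ind1StripOf (w i) (galoisLog (w i))),
      ∀ y : (w i).adicCompletion K, ‖e i y‖ ≤ ρ i → ‖e i (δ y)‖ ≤ ρ i := by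
    intro i δ hδ y hy
    rcases hmem i with rfl | rfl
    · simp only [ρ, if_pos rfl] at hy ⊢
      have hM := image_depthE_ball_eq_of_mem_closure_of_fixesBaseLine (w i) p (hw i) hp2 (he i) hf₀ (zpow_ne_zero (m - 1) hpQ) hfix₀ hδ
      have h1 : δ y ∈ δ '' {x | ‖e i x‖ ≤ ‖(p : ℚ_[p]) ^ (m - 1)‖ * (p : ℝ)⁻¹} := ⟨y, hy, rfl⟩
      rw [hM] at h1
      exact h1
    · simp only [ρ, if_neg hne.symm] at hy ⊢
      exact norm_of_apply_le_of_mem_closure_of_le p (w i) (hw i) hp2 (he i) (inv_ne_zero hpQ) hδ hy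
  have hprod : ∏ i, ρ i = ‖g‖ * (p : ℝ) ^ (1 - 1 / (E₁ : ℝ)) := by
    rw [huniv, Finset.prod_pair hne, hρ₀, hρ₁]
  rw [← hprod]
  exact packetHull_iUnion_image_subset_polydisc_of_subset_smul_integerPacket p w hw _ ρ hρ0 hh hstab H hHfac hReg

/-! ## §4 `E ∣ v + 1` (`r = E − 2`), failing bits at BOTH factors -/

include hne huniv in
/-- **§4 `E ∣ v + 1`, FAILING bits at BOTH factors (UNCONDITIONAL).**  Two tame factors of residue degree one; `‖g‖ = p^{−v/E}` with `E ∣ v + 1` (`r = E − 2`,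
`v = E·B + E − 1`); at NEITHER place does a realised strip automorphism move `ℤ_p·p` modulo `p·log_p(𝒪^×)`; `H` factorwise through the strip groups.  Then
the `(R_I)^∼`-hull of the `H`-orbit of `ι_{i₀}(g)·(R_I)^∼` lies in the polydisc of radius `‖g‖·p^{1−1/E} = p^{−B}`: Prop. 1.1 (`⋆ = i₁`) puts the region in the
box `⊗(g·d₀⁻¹, 1)·R_I` = `p^{B}·𝒪_{w_{i₀}} ⊗ 𝒪_{w_{i₁}}`, two depth-`e` balls with failing bits, both strip-INVARIANT (p550084).  Container radius
`p^{−B+1−1/E−1/e₁}`: defect `(1 − 1/E − 1/e₁)·log p`, positive unless `E = e₁ = 2` (§5); ONE bit at either factor removes it ((A′) §2).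
[claim: Mochizuki2012, status: disputed] [cite: Mochizuki2012, IUTchIII Thm. 3.11 (i) p. 154; Rmk. 3.9.5 (i) p. 127; IUTchIV Prop. 1.1 p. 9]
[cite: DupuyHilado2025, §4.9, §4.12] -/
theorem packetHull_orbit_smul_normalizedPacket_subset_polydisc_of_dvd_succ_of_fixesBaseLine (hp2 : 2 < p)
    (he : ∀ i, absRamificationIdx p (RescaledCompletion K p (w i) (hw i)) ≤ p - 2)
    {g : RescaledCompletion K p (w i₀) (hw i₀)} {v : ℤ}
    (hv : ‖g‖ = (p : ℝ) ^ (-(v / (absRamificationIdx p (RescaledCompletion K p (w i₀) (hw i₀)) : ℝ))))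
    (hdvd : ((absRamificationIdx p (RescaledCompletion K p (w i₀) (hw i₀)) : ℤ)) ∣ v + 1)
    (hf : ∀ i, (w i).asIdeal.inertiaDeg ℤ = 1)
    (hfix : ∀ i, ∀ ψ ∈ ind1StripOf (w i) (galoisLog (w i)),
      RescaledCompletion.of K p (w i) (hw i) (ψ (p : (w i).adicCompletion K)) - (p : RescaledCompletion K p (w i) (hw i)) ∈
        (p : ℚ_[p]) • logUnits (RescaledCompletion K p (w i) (hw i)))
    (H : Subgroup (PacketAlgebra p (fun i => RescaledCompletion K p (w i) (hw i)) ≃ₗ[ℚ_[p]]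
      PacketAlgebra p (fun i => RescaledCompletion K p (w i) (hw i))))
    (hHfac : ∀ γ ∈ H, ∃ δ : Π i, AddAut ((w i).adicCompletion K),
      (∀ i, δ i ∈ AddSubgroup.closure (G := AddAut ((w i).adicCompletion K)) (ind1StripOf (w i) (galoisLog (w i)))) ∧
      ∀ z : Π i, RescaledCompletion K p (w i) (hw i),
        γ (PiTensorProduct.tprod ℚ_[p] z) =
          PiTensorProduct.tprod ℚ_[p] (fun i => RescaledCompletion.of K p (w i) (hw i)
            (δ i ((RescaledCompletion.of K p (w i) (hw i)).symm (z i))))) :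
    packetHull p (fun i => RescaledCompletion K p (w i) (hw i))
        (⋃ γ : H, (γ : PacketAlgebra p (fun i => RescaledCompletion K p (w i) (hw i)) ≃ₗ[ℚ_[p]]
            PacketAlgebra p (fun i => RescaledCompletion K p (w i) (hw i))) ''
          (iota p (fun i => RescaledCompletion K p (w i) (hw i)) i₀ g •
            (normalizedPacket p (fun i => RescaledCompletion K p (w i) (hw i)) :
              Set (PacketAlgebra p (fun i => RescaledCompletion K p (w i) (hw i)))))) ⊆
      dEquiv p (fun i => RescaledCompletion K p (w i) (hw i)) ⁻¹'
        polydisc (DFac p (fun i => RescaledCompletion K p (w i) (hw i)))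
          (fun _ => ‖g‖ * (p : ℝ) ^ (1 - 1 / (absRamificationIdx p (RescaledCompletion K p (w i₀) (hw i₀)) : ℝ))) := by
  classical
  set k := fun i => RescaledCompletion K p (w i) (hw i) with hk
  set e := fun i => RescaledCompletion.of K p (w i) (hw i) with he_def
  set E : ℕ := absRamificationIdx p (k i₀) with hE
  haveI : Nonempty I := ⟨i₀⟩
  have hP : p.Prime := Fact.out
  have hp0 : (0 : ℝ) < p := by exact_mod_cast hP.pos
  have hpQ : (p : ℚ_[p]) ≠ 0 := by exact_mod_cast hP.ne_zero
  have hE0 : (0 : ℝ) < (E : ℝ) := by exact_mod_cast absRamificationIdx_pos p (k i₀)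
  have hmem : ∀ i, i = i₀ ∨ i = i₁ := fun i => by
    have hm := Finset.mem_univ i
    rw [huniv, Finset.mem_insert, Finset.mem_singleton] at hm
    exact hm
  obtain ⟨m, hm⟩ := hdvd
  have hvE : (v : ℝ) / (E : ℝ) = m - 1 / (E : ℝ) := by
    rw [show (v : ℝ) = (E : ℝ) * m - 1 by exact_mod_cast (show v = (E : ℤ) * m - 1 by linear_combination hm)]
    field_simp
  have hgn : ‖g‖ * (p : ℝ) ^ (1 - 1 / (E : ℝ)) = (p : ℝ) ^ (-(m : ℝ) + 1) := by
    rw [hv, show (v : ℝ) / (absRamificationIdx p (RescaledCompletion K p (w i₀) (hw i₀)) : ℝ) = (v : ℝ) / (E : ℝ) from rfl, hvE,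
      ← Real.rpow_add hp0]
    ring_nf
  -- the different generator at `i₀` and the box `⊗(g·d₀⁻¹, 1)·R_I ⊇ ι_{i₀}(g)·(R_I)^∼`
  obtain ⟨d₀, hd₀, hd₀0, hnd₀⟩ := exists_different_generator_norm_eq p (k i₀) (he i₀)
  have hReg : iota p k i₀ g • (normalizedPacket p k : Set (PacketAlgebra p k)) ⊆
      purePacket p k (Pi.mulSingle i₀ (g * ((d₀ : k i₀))⁻¹)) • (integerPacket p k : Set (PacketAlgebra p k)) := by
    refine (Set.smul_set_mono (normalizedPacket_subset_iota_smul_integerPacket_of_two p k i₀ i₁ hne huniv d₀ hd₀ hd₀0)).trans ?_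
    rw [smul_smul, ← map_mul, iota_eq_purePacket]
  -- radii: `ρ_{i₀} = ‖p^{m−2}‖·p⁻¹ = p^{−m+1} = ‖g·d₀⁻¹‖`, `ρ_{i₁} = ‖p⁻¹‖·p⁻¹ = 1` (two depth-`e` balls)
  let ρ : I → ℝ := fun i => if i = i₀ then ‖((p : ℚ_[p]) ^ (m - 2))‖ * (p : ℝ)⁻¹ else ‖((p : ℚ_[p])⁻¹)‖ * (p : ℝ)⁻¹
  have hρ₀ : ρ i₀ = (p : ℝ) ^ (-(m : ℝ) + 1) := by
    simp only [ρ, if_pos rfl]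
    rw [norm_zpow, Padic.norm_p, inv_zpow', ← Real.rpow_intCast, ← Real.rpow_neg_one, ← Real.rpow_add hp0]
    push_cast; ring_nf
  have hρ₁ : ρ i₁ = 1 := by
    simp only [ρ, if_neg hne.symm]
    rw [norm_inv, Padic.norm_p, inv_inv, mul_inv_cancel₀ hp0.ne']
  have hρ0 : ∀ i, 0 ≤ ρ i := fun i => by simp only [ρ]; split_ifs <;> positivity
  have hh : ∀ i, ‖(Pi.mulSingle i₀ (g * ((d₀ : k i₀))⁻¹) : Π i, k i) i‖ ≤ ρ i := by
    intro i
    rcases hmem i with rfl | rfl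
    · rw [Pi.mulSingle_eq_same, hρ₀, norm_mul, norm_inv, hnd₀, ← Real.rpow_neg hp0.le, neg_neg, ← hE, sub_div, div_self hE0.ne',
        hgn]
    · rw [Pi.mulSingle_eq_of_ne hne.symm, norm_one, hρ₁]
  have hstab : ∀ i, ∀ δ ∈ AddSubgroup.closure (G := AddAut ((w i).adicCompletion K)) (ind1StripOf (w i) (galoisLog (w i))),
      ∀ y : (w i).adicCompletion K, ‖e i y‖ ≤ ρ i → ‖e i (δ y)‖ ≤ ρ i := by
    intro i δ hδ y hy
    rcases hmem i with rfl | rfl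
    · simp only [ρ, if_pos rfl] at hy ⊢
      have hM := image_depthE_ball_eq_of_mem_closure_of_fixesBaseLine (w i) p (hw i) hp2 (he i) (hf i) (zpow_ne_zero (m - 2) hpQ) (hfix i) hδ
      have h1 : δ y ∈ δ '' {x | ‖e i x‖ ≤ ‖(p : ℚ_[p]) ^ (m - 2)‖ * (p : ℝ)⁻¹} := ⟨y, hy, rfl⟩
      rw [hM] at h1
      exact h1
    · simp only [ρ, if_neg hne.symm] at hy ⊢
      have hM := image_depthE_ball_eq_of_mem_closure_of_fixesBaseLine (w i) p (hw i) hp2 (he i) (hf i) (inv_ne_zero hpQ) (hfix i) hδ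
      have h1 : δ y ∈ δ '' {x | ‖e i x‖ ≤ ‖(p : ℚ_[p])⁻¹‖ * (p : ℝ)⁻¹} := ⟨y, hy, rfl⟩
      rw [hM] at h1
      exact h1
  have hprod : ∏ i, ρ i = ‖g‖ * (p : ℝ) ^ (1 - 1 / (E : ℝ)) := by
    rw [huniv, Finset.prod_pair hne, hρ₀, hρ₁, mul_one, hgn]
  rw [← hprod]
  exact packetHull_iUnion_image_subset_polydisc_of_subset_smul_integerPacket p w hw _ ρ hρ0 hh hstab H hHfac hReg

/-! ## §5 Strictness: each confinement radius is below the container's attained radius -/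

/-- **A hull confined to a polydisc of radius `R' < ‖p^{A}‖·∏_i p^{−1/e_i}` is NOT the container's hull** (tame factors of local degree `≥ 2`): the container
span `p^{A}·log_p(R_I^×)` has an element outside that polydisc ((B) §1), which lies in `packetHull(p^{A}·log_p(R_I^×))`. UNCONDITIONAL.
[claim: Mochizuki2012, status: disputed] [cite: Mochizuki2012, IUTchIII Rmk. 3.9.5 (i) p. 127; IUTchIV Prop. 1.4 (i) p. 13] [cite: DupuyHilado2025, §4.12] -/
theorem packetHull_ne_of_subset_polydisc_of_lt [Nonempty I] (hp2 : 2 < p)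
    (he : ∀ i, absRamificationIdx p (RescaledCompletion K p (w i) (hw i)) ≤ p - 2) (hd2 : ∀ i, 2 ≤ localDeg K (w i)) (A : ℤ) {R' : ℝ}
    (hR' : R' < ‖(p : ℚ_[p]) ^ A‖ * ∏ i, (p : ℝ) ^ (-(1 / (absRamificationIdx p (RescaledCompletion K p (w i) (hw i)) : ℝ))))
    {O : Set (PacketAlgebra p (fun i => RescaledCompletion K p (w i) (hw i)))}
    (hO : packetHull p (fun i => RescaledCompletion K p (w i) (hw i)) O ⊆
      dEquiv p (fun i => RescaledCompletion K p (w i) (hw i)) ⁻¹' polydisc (DFac p (fun i => RescaledCompletion K p (w i) (hw i))) (fun _ => R')) :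
    packetHull p (fun i => RescaledCompletion K p (w i) (hw i)) O ≠
      packetHull p (fun i => RescaledCompletion K p (w i) (hw i))
        (((p : ℚ_[p]) ^ A) • (logPacket p (fun i => RescaledCompletion K p (w i) (hw i)) :
          Set (PacketAlgebra p (fun i => RescaledCompletion K p (w i) (hw i))))) := by
  intro hEq
  obtain ⟨y, hy, hyn⟩ := exists_mem_zpow_smul_logPacket_not_mem_polydisc p w hw hp2 he hd2 A hR'
  exact hyn (hO (hEq ▸ subset_packetHull p _ _ hy))

include hne huniv in
/-- **Radius comparisons (pure arithmetic of the two-factor packet).**  With `‖g‖ = p^{−v/E}` and `A = (v−1) div E + 1 − 2`: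
(a) `E ∣ v`, `e₁ ≥ 2` ⟹ `‖g‖·p^{1−1/E} < ‖p^{A}‖·p^{−1/E}·p^{−1/e₁}` ((B) §2, defect `(1−1/e₁)·log p`);
(b) `E ∣ v`, `E ≥ 2` ⟹ `‖g‖·p^{1−1/e₁} <` the same (§3, defect `(1−1/E)·log p`);
(c) `E ∣ v+1`, `1/E + 1/e₁ < 1` ⟹ `‖g‖·p^{1−1/E} <` the same (§4, defect `(1−1/E−1/e₁)·log p`).  Feed into `packetHull_ne_of_subset_polydisc_of_lt`.
[cite: Mochizuki2012, IUTchIV Prop. 1.2 (ii) p. 10] -/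
theorem radius_lt_container {g : RescaledCompletion K p (w i₀) (hw i₀)} {v : ℤ}
    (hv : ‖g‖ = (p : ℝ) ^ (-(v / (absRamificationIdx p (RescaledCompletion K p (w i₀) (hw i₀)) : ℝ)))) :
    ((((absRamificationIdx p (RescaledCompletion K p (w i₀) (hw i₀)) : ℤ)) ∣ v) →
      2 ≤ absRamificationIdx p (RescaledCompletion K p (w i₁) (hw i₁)) →
      ‖g‖ * (p : ℝ) ^ (1 - 1 / (absRamificationIdx p (RescaledCompletion K p (w i₀) (hw i₀)) : ℝ)) <
        ‖(p : ℚ_[p]) ^ ((v - 1) / (absRamificationIdx p (RescaledCompletion K p (w i₀) (hw i₀)) : ℤ) + 1 - Fintype.card I)‖ *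
          ∏ i, (p : ℝ) ^ (-(1 / (absRamificationIdx p (RescaledCompletion K p (w i) (hw i)) : ℝ)))) ∧
    ((((absRamificationIdx p (RescaledCompletion K p (w i₀) (hw i₀)) : ℤ)) ∣ v) →
      2 ≤ absRamificationIdx p (RescaledCompletion K p (w i₀) (hw i₀)) →
      ‖g‖ * (p : ℝ) ^ (1 - 1 / (absRamificationIdx p (RescaledCompletion K p (w i₁) (hw i₁)) : ℝ)) <
        ‖(p : ℚ_[p]) ^ ((v - 1) / (absRamificationIdx p (RescaledCompletion K p (w i₀) (hw i₀)) : ℤ) + 1 - Fintype.card I)‖ *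
          ∏ i, (p : ℝ) ^ (-(1 / (absRamificationIdx p (RescaledCompletion K p (w i) (hw i)) : ℝ)))) ∧
    ((((absRamificationIdx p (RescaledCompletion K p (w i₀) (hw i₀)) : ℤ)) ∣ v + 1) →
      (1 : ℝ) / (absRamificationIdx p (RescaledCompletion K p (w i₀) (hw i₀)) : ℝ) +
          1 / (absRamificationIdx p (RescaledCompletion K p (w i₁) (hw i₁)) : ℝ) < 1 →
      ‖g‖ * (p : ℝ) ^ (1 - 1 / (absRamificationIdx p (RescaledCompletion K p (w i₀) (hw i₀)) : ℝ)) <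
        ‖(p : ℚ_[p]) ^ ((v - 1) / (absRamificationIdx p (RescaledCompletion K p (w i₀) (hw i₀)) : ℤ) + 1 - Fintype.card I)‖ *
          ∏ i, (p : ℝ) ^ (-(1 / (absRamificationIdx p (RescaledCompletion K p (w i) (hw i)) : ℝ)))) := by
  classical
  set E : ℕ := absRamificationIdx p (RescaledCompletion K p (w i₀) (hw i₀)) with hE
  set E₁ : ℕ := absRamificationIdx p (RescaledCompletion K p (w i₁) (hw i₁)) with hE₁
  have hP : p.Prime := Fact.out
  have hp0 : (0 : ℝ) < p := by exact_mod_cast hP.pos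
  have hp1 : (1 : ℝ) < p := by exact_mod_cast hP.one_lt
  have hEpos : 0 < E := absRamificationIdx_pos p _
  have hE₁pos : 0 < E₁ := absRamificationIdx_pos p _
  have hE0 : (0 : ℝ) < (E : ℝ) := by exact_mod_cast hEpos
  have hE₁0 : (0 : ℝ) < (E₁ : ℝ) := by exact_mod_cast hE₁pos
  have hcard : Fintype.card I = 2 := by rw [← Finset.card_univ, huniv, Finset.card_pair hne]
  -- the container radius as ONE power of `p`
  have hR : ∀ A : ℤ, ‖(p : ℚ_[p]) ^ A‖ * ∏ i, (p : ℝ) ^ (-(1 / (absRamificationIdx p (RescaledCompletion K p (w i) (hw i)) : ℝ))) =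
      (p : ℝ) ^ (-(A : ℝ) - 1 / (E : ℝ) - 1 / (E₁ : ℝ)) := by
    intro A
    rw [huniv, Finset.prod_pair hne]
    simp only [← hE, ← hE₁]
    rw [norm_zpow, Padic.norm_p, inv_zpow', ← Real.rpow_intCast, ← Real.rpow_add hp0, ← Real.rpow_add hp0]
    push_cast; ring_nf
  have hgp : ∀ x : ℝ, ‖g‖ * (p : ℝ) ^ x = (p : ℝ) ^ (-((v : ℝ) / (E : ℝ)) + x) := fun x => by rw [hv, ← Real.rpow_add hp0]
  refine ⟨fun hdvd he₁ => ?_, fun hdvd he₀ => ?_, fun hdvd hlt => ?_⟩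
  · obtain ⟨m, hm⟩ := hdvd
    have hA : (v - 1) / (E : ℤ) + 1 - Fintype.card I = m - 2 := by
      rw [hcard, hm, show (E : ℤ) * m - 1 = (E - 1) + (E : ℤ) * (m - 1) by ring, Int.add_mul_ediv_left _ _ (by exact_mod_cast hEpos.ne'),
        Int.ediv_eq_zero_of_lt (by omega) (by omega)]
      push_cast; ring
    rw [hA, hR, hgp]
    refine Real.rpow_lt_rpow_of_exponent_lt hp1 ?_
    have h1 : (v : ℝ) / (E : ℝ) = m := by rw [hm]; push_cast; field_simp
    have h2 : (1 : ℝ) / (E₁ : ℝ) ≤ 1 / 2 := one_div_le_one_div_of_le (by norm_num) (by exact_mod_cast he₁)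
    rw [h1]; push_cast; linarith
  · obtain ⟨m, hm⟩ := hdvd
    have hA : (v - 1) / (E : ℤ) + 1 - Fintype.card I = m - 2 := by
      rw [hcard, hm, show (E : ℤ) * m - 1 = (E - 1) + (E : ℤ) * (m - 1) by ring, Int.add_mul_ediv_left _ _ (by exact_mod_cast hEpos.ne'),
        Int.ediv_eq_zero_of_lt (by omega) (by omega)]
      push_cast; ring
    rw [hA, hR, hgp]
    refine Real.rpow_lt_rpow_of_exponent_lt hp1 ?_
    have h1 : (v : ℝ) / (E : ℝ) = m := by rw [hm]; push_cast; field_simp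
    have h2 : (1 : ℝ) / (E : ℝ) ≤ 1 / 2 := one_div_le_one_div_of_le (by norm_num) (by exact_mod_cast he₀)
    rw [h1]; push_cast; linarith
  · obtain ⟨m, hm⟩ := hdvd
    have hE2 : 2 ≤ E := by
      by_contra hlt'
      have h1 : E = 1 := by omega
      have : (1 : ℝ) ≤ 1 / (E : ℝ) := by rw [h1]; norm_num
      have : (0 : ℝ) < 1 / (E₁ : ℝ) := by positivity
      linarith
    have hA : (v - 1) / (E : ℤ) + 1 - Fintype.card I = m - 2 := by
      rw [hcard, show v - 1 = (E - 2) + (E : ℤ) * (m - 1) by linear_combination hm, Int.add_mul_ediv_left _ _ (by exact_mod_cast hEpos.ne'),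
        Int.ediv_eq_zero_of_lt (by omega) (by omega)]
      push_cast; ring
    rw [hA, hR, hgp]
    refine Real.rpow_lt_rpow_of_exponent_lt hp1 ?_
    have h1 : (v : ℝ) / (E : ℝ) = m - 1 / (E : ℝ) := by
      rw [show (v : ℝ) = (E : ℝ) * m - 1 by exact_mod_cast (show v = (E : ℤ) * m - 1 by linear_combination hm)]
      field_simp
    rw [h1]; push_cast; linarith

end Summit.ABC.IUTFork.Thm311.Real
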